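import Literature.Computability.AlgebraicComplexity.BurgisserThm41Proofs
import Literature.Computability.AlgebraicComplexity.QPBoundedClosure
import Summits.ValiantsHypothesis.ValiantsHypothesis.Theorems.IntegralOrbitsTauBurgisserDetStubChCollapseQP
import HarnessLib

/-!
# Crux `TauBurgisserDet` (stmt-ValiantsHypothesis-7680), line `registered` — stub `stub_transferQP`

Bürgisser 2009, Thm. 4.1(2), re-run at QUASI-POLYNOMIAL granularity with POWERS `d` and an integer
MULTIPLIER `N` (the algebraic side of the crux `TauConjecture → ¬ SignDetQP`): for every coefficient sequence
`(b(n,k))_{k ≤ q(n)}` definable in `CH`, if `CH ⊆ qpSIZE` and sign-determinantal expressions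
`det A = N · per_n^d` of quasi-polynomial size exist for all large `n`, then for all large `n` some
`N ≠ 0, e, d ≥ 1` have `τ(N · (2^e · Σ_{k ≤ q(n)} b(n,k) X^k)^d) ≤ 2^((log₂ log₂ n + c)^c)`.

This file is the ASSEMBLY (stub 3c of the lead's skeleton): it takes as hypotheses the statements of the two
sibling stubs — the signed two-block Koiran witness at explicit size (`stub_transferWitness`, 3a) and the explicit
algebraic core "Thm. 2.10 + sign-determinantal expression at the padded dimension + constant-free determinant"
(`stub_transferCore`, 3b) — together with `τ(DET_m) = m^{O(1)}` (stub `stub_tauDetCF`, landed), and performs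
(i) the sign handling at the `CH` level (`L± = Bit(|b|) ∩ {sgn b ≥ 0}^{±}`, `inter_mem_CH`, `CH_closed_fst`,
`compl_mem_CH`), (ii) the passage `CH ⊆ qpSIZE` to two circuit families of size `≤ 2^((log m + c)^c)` and the
block size `M = 2^((log (8r+9) + c')^c')`, `r = ℓ + μ = bitLen (p n) + bitLen (q n)`, (iii) the substitution
`Y_i ↦ 2^{2^i}`, `Z_i ↦ X^{2^i}` after `blockSubst` (cost `ℓ² + μ²`), which turns `B⁺_n − B⁻_n` into
`Σ_k b(n,k) X^k` (`aeval_twoBlockPoly_powers`, `sum_bits_posPart/negPart`, valid for `n ≥ 2`), and (iv) the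
quasi-polynomial bookkeeping: the core bound is qp in `r` (`IsQPBounded` calculus of `QPBoundedClosure.lean`,
`ChCollapseQP.qp_comp` for qp ∘ qp) and `r = O(log n)` (`polylog_bitLen`), whence `2^((log log n + c)^c)`.
Template: `thm41_2_signPart_PPoly` / `Burgisser2009_thm41_2_of_steps` (`BurgisserThm41Proofs.lean`).

References: P. Bürgisser, *On defining integers and proving arithmetic circuit lower bounds*, Comput. Complexity
18 (2009), Thm. 4.1(2) and its proof (ECCC TR06-113, pp. 14–15); P. Koiran, Comput. Complexity 13 (2004),
Thm. 4.3, Thm. 6.1.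
-/

set_option linter.dupNamespace false

noncomputable section

open MvPolynomial Computability Literature.Computability.Complexity
open Literature.Computability.AlgebraicComplexity

namespace Summit.ValiantsHypothesis.ValiantsHypothesis.Theorems.IntegralOrbitsTauBurgisserDet

namespace TransferQP

/-! ### Quasi-polynomial bookkeeping in the digit count `r = ℓ + μ` -/

/-- qp ∘ qp = qp in `IsQPBounded` form: along a qp-bounded `t`, `r ↦ 2^((log₂ (t r) + e)^e)` is qp-bounded
(`ChCollapseQP.qp_comp`). [folklore] -/
theorem isQPBounded_two_pow_qexp_log' {t : ℕ → ℕ} (ht : IsQPBounded t) (e : ℕ) :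
    IsQPBounded fun r => 2 ^ ((Nat.log 2 (t r) + e) ^ e) := by
  obtain ⟨c, hc⟩ := ht
  obtain ⟨c', hc'⟩ := ChCollapseQP.qp_comp c e
  exact ⟨c', fun r => hc' r (t r) (hc r)⟩

/-- Bürgisser's `cfBound` is qp-bounded along qp-bounded arguments (it is a polynomial in them). [folklore] -/
theorem isQPBounded_cfBound {s δ u : ℕ → ℕ} (hs : IsQPBounded s) (hδ : IsQPBounded δ) (hu : IsQPBounded u) :
    IsQPBounded fun r => ArithCircuit.cfBound (s r) (δ r) (u r) := by
  unfold ArithCircuit.cfBound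
  exact ((((IsQPBounded.const 34).mul ((hu.add ((IsQPBounded.const 5).mul hs)).add (IsQPBounded.const 2))).mul
    (((hs.add (IsQPBounded.const 1)).mul hδ).add (IsQPBounded.const 2))).add (IsQPBounded.const 13))

/-- **The core bound is quasi-polynomial in `r`.** With `M = 2^((log (8r+9) + c')^c')`, `S = 160 (r+M+1)^5 + 6`,
`D = 6 (r+M) + 15`, `u = r + M + 1`, `Pd = max n₀ (cfBound S D u + S + 2)`, `mb = 2^((log Pd + cA)^cA)`:
`mb^cd + cd + mb² (Pd³ + 4 Pd² + 1) + r² ≤ 2^((log r + cT)^cT)` for one constant `cT`. [folklore] -/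
theorem coreBound_qp (c' cA cd n₀ : ℕ) : ∃ cT : ℕ, ∀ r M S D u Pd mb : ℕ,
    M = 2 ^ ((Nat.log 2 (8 * r + 9) + c') ^ c') → S = 160 * (r + M + 1) ^ 5 + 6 → D = 6 * (r + M) + 15 →
    u = r + M + 1 → Pd = max n₀ (ArithCircuit.cfBound S D u + S + 2) → mb = 2 ^ ((Nat.log 2 Pd + cA) ^ cA) →
    mb ^ cd + cd + mb ^ 2 * (Pd ^ 3 + 4 * Pd ^ 2 + 1) + r ^ 2 ≤ 2 ^ ((Nat.log 2 r + cT) ^ cT) := by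
  have hr : IsQPBounded fun r : ℕ => r := IsPBounded.id.isQPBounded
  have hlin : IsPBounded fun r : ℕ => 8 * r + 9 :=
    IsPBounded.add_holds (IsPBounded.mul_holds (IsPBounded.const 8) IsPBounded.id) (IsPBounded.const 9)
  have hM : IsQPBounded fun r : ℕ => 2 ^ ((Nat.log 2 (8 * r + 9) + c') ^ c') :=
    IsQPBounded.two_pow_qexp_log hlin c'
  have hrM1 : IsQPBounded fun r : ℕ => r + 2 ^ ((Nat.log 2 (8 * r + 9) + c') ^ c') + 1 :=
    (hr.add hM).add (IsQPBounded.const 1)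
  have hS : IsQPBounded fun r : ℕ => 160 * (r + 2 ^ ((Nat.log 2 (8 * r + 9) + c') ^ c') + 1) ^ 5 + 6 :=
    ((IsQPBounded.const 160).mul (hrM1.pow 5)).add (IsQPBounded.const 6)
  have hD : IsQPBounded fun r : ℕ => 6 * (r + 2 ^ ((Nat.log 2 (8 * r + 9) + c') ^ c')) + 15 :=
    ((IsQPBounded.const 6).mul (hr.add hM)).add (IsQPBounded.const 15)
  have hPd : IsQPBounded fun r : ℕ => max n₀ (ArithCircuit.cfBound
      (160 * (r + 2 ^ ((Nat.log 2 (8 * r + 9) + c') ^ c') + 1) ^ 5 + 6)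
      (6 * (r + 2 ^ ((Nat.log 2 (8 * r + 9) + c') ^ c')) + 15)
      (r + 2 ^ ((Nat.log 2 (8 * r + 9) + c') ^ c') + 1) +
      (160 * (r + 2 ^ ((Nat.log 2 (8 * r + 9) + c') ^ c') + 1) ^ 5 + 6) + 2) :=
    ((IsQPBounded.const n₀).add (((isQPBounded_cfBound hS hD hrM1).add hS).add (IsQPBounded.const 2))).mono
      fun r => max_le (Nat.le_add_right _ _) (Nat.le_add_left _ _)
  have hmb := isQPBounded_two_pow_qexp_log' hPd cA
  have hT := (((hmb.pow cd).add (IsQPBounded.const cd)).add ((hmb.pow 2).mul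
    (((hPd.pow 3).add ((IsQPBounded.const 4).mul (hPd.pow 2))).add (IsQPBounded.const 1)))).add (hr.pow 2)
  obtain ⟨cT, hcT⟩ := hT
  refine ⟨cT, fun r M S D u Pd mb hM' hS' hD' hu' hPd' hmb' => ?_⟩
  subst hM' hS' hD' hu'
  subst hPd'
  subst hmb'
  exact hcT r

/-- `log₂ (L + 2) ≤ log₂ L + 2`. [folklore] -/
theorem log_add_two_le (L : ℕ) : Nat.log 2 (L + 2) ≤ Nat.log 2 L + 2 :=
  calc Nat.log 2 (L + 2) ≤ Nat.log 2 (2 ^ (Nat.log 2 L + 2)) := Nat.log_mono_right (add_two_le_two_pow_log L)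
    _ = Nat.log 2 L + 2 := Nat.log_pow Nat.one_lt_two _

/-- `log₂ ((L + 2)^c) ≤ c (log₂ L + 3)`. [folklore] -/
theorem log_pow_add_two_le (L c : ℕ) : Nat.log 2 ((L + 2) ^ c) ≤ c * (Nat.log 2 L + 3) := by
  have h1 : (L + 2) ^ c ≤ 2 ^ (c * (Nat.log 2 (L + 2) + 1)) :=
    calc (L + 2) ^ c ≤ (2 ^ (Nat.log 2 (L + 2) + 1)) ^ c :=
          Nat.pow_le_pow_left (Nat.lt_pow_succ_log_self Nat.one_lt_two _).le c
      _ = 2 ^ (c * (Nat.log 2 (L + 2) + 1)) := by rw [← pow_mul, Nat.mul_comm]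
  calc Nat.log 2 ((L + 2) ^ c) ≤ Nat.log 2 (2 ^ (c * (Nat.log 2 (L + 2) + 1))) := Nat.log_mono_right h1
    _ = c * (Nat.log 2 (L + 2) + 1) := Nat.log_pow Nat.one_lt_two _
    _ ≤ c * (Nat.log 2 L + 3) := Nat.mul_le_mul_left c (by have := log_add_two_le L; omega)

/-- **From "qp in `r`" and "`r` polylog in `n`" to "qp in `log n`"**: if `r ≤ (log₂ n + 2)^cR` then
`2^((log₂ r + cT)^cT) ≤ 2^((log₂ log₂ n + c)^c)` with `c = 3 cR + cT + 1 + 2 cT`. [folklore] -/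
theorem final_bound (cT cR : ℕ) : ∃ c : ℕ, ∀ n r : ℕ, r ≤ (Nat.log 2 n + 2) ^ cR →
    2 ^ ((Nat.log 2 r + cT) ^ cT) ≤ 2 ^ ((Nat.log 2 (Nat.log 2 n) + c) ^ c) := by
  set K := 3 * cR + cT + 1 with hK
  refine ⟨K + 2 * cT, fun n r hr => Nat.pow_le_pow_right Nat.two_pos ?_⟩
  set x := Nat.log 2 (Nat.log 2 n) with hx
  have h1 : Nat.log 2 r ≤ cR * (x + 3) :=
    (Nat.log_mono_right hr).trans (log_pow_add_two_le _ _)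
  have h2 : Nat.log 2 r + cT ≤ (x + K) ^ 2 := by
    have h3 : Nat.log 2 r + cT ≤ K * (x + K) := by rw [hK]; nlinarith
    calc Nat.log 2 r + cT ≤ K * (x + K) := h3
      _ ≤ (x + K) * (x + K) := Nat.mul_le_mul_right _ (Nat.le_add_left _ _)
      _ = (x + K) ^ 2 := (pow_two _).symm
  calc (Nat.log 2 r + cT) ^ cT ≤ ((x + K) ^ 2) ^ cT := Nat.pow_le_pow_left h2 cT
    _ = (x + K) ^ (2 * cT) := by rw [← pow_mul]
    _ ≤ (x + (K + 2 * cT)) ^ (2 * cT) := Nat.pow_le_pow_left (by omega) _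
    _ ≤ (x + (K + 2 * cT)) ^ (K + 2 * cT) := Nat.pow_le_pow_right (by omega) (by omega)


/-! ### The substituted signed two-block polynomial is `Σ_k b(n,k) X^k` -/

/-- **`B⁺_n − B⁻_n` under the powers is `Σ_k b(n,k) X^k`** (ECCC TR06-113, p. 14, with the sign split
`b = b⁺ − b⁻` done inside ONE polynomial): if the two 0/1 arrays are the bit arrays of `b⁺` and `b⁻` on
`k ≤ q n` and `|b(n,k)| < 2^{p n + 1}` there. [cite: Burgisser2006, proof of Thm. 4.1(2)] -/
theorem aeval_powers_twoBlockPoly_sub (p q : ℕ → ℕ) (b : ℕ → ℕ → ℤ) (bp bm : ℕ → ℕ → ℕ → Bool) (n : ℕ)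
    (hbp : ∀ k j, k ≤ q n → bp n k j = (decide (0 ≤ b n k) && (b n k).natAbs.testBit j))
    (hbm : ∀ k j, k ≤ q n → bm n k j = (decide (b n k < 0) && (b n k).natAbs.testBit j))
    (hbits : ∀ k, k ≤ q n → (b n k).natAbs < 2 ^ (p n + 1)) :
    aeval (Sum.elim (fun i : Fin (bitLen (p n)) => (C (2 : ℤ) : MvPolynomial (Fin 1) ℤ) ^ 2 ^ (i : ℕ))
        (fun i : Fin (bitLen (q n)) => (X 0 : MvPolynomial (Fin 1) ℤ) ^ 2 ^ (i : ℕ)))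
        (twoBlockPoly p q bp n - twoBlockPoly p q bm n) =
      ∑ k ∈ Finset.range (q n + 1), C (b n k) * (X 0 : MvPolynomial (Fin 1) ℤ) ^ k := by
  rw [map_sub, aeval_twoBlockPoly_powers, aeval_twoBlockPoly_powers, ← Finset.sum_sub_distrib]
  refine Finset.sum_congr rfl fun k hk => ?_
  have hk' : k ≤ q n := Nat.lt_succ_iff.1 (Finset.mem_range.1 hk)
  rw [← sub_mul]
  congr 1
  have hp : (∑ j ∈ Finset.range (p n + 1), if bp n k j then (C (2 : ℤ) : MvPolynomial (Fin 1) ℤ) ^ j else 0) =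
      ∑ j ∈ Finset.range (p n + 1),
        if (decide (0 ≤ b n k) && (b n k).natAbs.testBit j) then (C (2 : ℤ) : MvPolynomial (Fin 1) ℤ) ^ j else 0 :=
    Finset.sum_congr rfl fun j _ => by rw [hbp k j hk']
  have hm : (∑ j ∈ Finset.range (p n + 1), if bm n k j then (C (2 : ℤ) : MvPolynomial (Fin 1) ℤ) ^ j else 0) =
      ∑ j ∈ Finset.range (p n + 1),
        if (decide (b n k < 0) && (b n k).natAbs.testBit j) then (C (2 : ℤ) : MvPolynomial (Fin 1) ℤ) ^ j else 0 :=
    Finset.sum_congr rfl fun j _ => by rw [hbm k j hk']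
  rw [hp, hm, sum_bits_posPart (hbits k hk'), sum_bits_negPart (hbits k hk'), ← map_sub]
  congr 1
  by_cases h0 : 0 ≤ b n k
  · rw [if_pos h0, if_neg (not_lt.2 h0), sub_zero]
  · rw [if_neg h0, if_pos (not_le.1 h0), zero_sub, neg_neg]

/-- `tauPoly` of `N · (2^e · Σ_k b_k X^k)^d` is `τ` of the corresponding element of `MvPolynomial (Fin 1) ℤ`
(through `uniqueAlgEquiv`; cf. `tauPoly_C_mul_sum`). [cite: Burgisser2006, Def. 2.6] -/
theorem tauPoly_C_mul_pow_sum (N : ℤ) (e d q : ℕ) (b : ℕ → ℤ) :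
    tauPoly (Polynomial.C N * (Polynomial.C ((2 : ℤ) ^ e) *
        ∑ k ∈ Finset.range (q + 1), Polynomial.C (b k) * Polynomial.X ^ k) ^ d) =
      constantFreeComplexity (C N * (C ((2 : ℤ) ^ e) *
        ∑ k ∈ Finset.range (q + 1), C (b k) * (X 0 : MvPolynomial (Fin 1) ℤ) ^ k) ^ d) := by
  rw [tauPoly_def]
  congr 1
  rw [MvPolynomial.uniqueAlgEquiv_symm_apply, Polynomial.eval₂_mul, Polynomial.eval₂_C, Polynomial.eval₂_pow,
    Polynomial.eval₂_mul, Polynomial.eval₂_C, Polynomial.eval₂_finsetSum]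
  congr 3
  refine Finset.sum_congr rfl fun k _ => ?_
  rw [Polynomial.eval₂_mul, Polynomial.eval₂_C, Polynomial.eval₂_X_pow, Fin.default_eq_zero]

/-- The cost of the combined substitution `powers ∘ blockSubst` is at most `ℓ² + μ²` (the digit variables go to
the constants `0, 1`, free; the powers by repeated squaring). [cite: Burgisser2006, proof of Thm. 4.1(2)] -/
theorem sum_cost_powers_blockSubst (p q : ℕ → ℕ) (n : ℕ) :
    ∑ v : KoiranVars (bitLen (p n)) (bitLen (q n)), constantFreeComplexity
        (aeval (Sum.elim (fun i : Fin (bitLen (p n)) => (C (2 : ℤ) : MvPolynomial (Fin 1) ℤ) ^ 2 ^ (i : ℕ))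
          (fun i : Fin (bitLen (q n)) => (X 0 : MvPolynomial (Fin 1) ℤ) ^ 2 ^ (i : ℕ))) (blockSubst p q n v)) ≤
      bitLen (p n) ^ 2 + bitLen (q n) ^ 2 := by
  rw [Fintype.sum_sum_type]
  have h0 : ∀ v : Fin (bitLen (p n) + bitLen (q n)) ⊕ (Fin (bitLen (p n)) ⊕ Fin (bitLen (q n))),
      constantFreeComplexity
        (aeval (Sum.elim (fun i : Fin (bitLen (p n)) => (C (2 : ℤ) : MvPolynomial (Fin 1) ℤ) ^ 2 ^ (i : ℕ))
          (fun i : Fin (bitLen (q n)) => (X 0 : MvPolynomial (Fin 1) ℤ) ^ 2 ^ (i : ℕ)))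
          (blockSubst p q n (Sum.inr v))) = 0 := by
    intro v
    rcases v with v | v | v <;>
      simp only [blockSubst, Sum.elim_inr, Sum.elim_inl, aeval_C, algebraMap_eq] <;>
      exact constantFreeComplexity_C_toNat _
  rw [Finset.sum_eq_zero fun v _ => h0 v, add_zero]
  refine le_of_eq_of_le ?_ (sum_constantFreeComplexity_powers_le (bitLen (p n)) (bitLen (q n)))
  refine Finset.sum_congr rfl fun v _ => ?_
  simp only [blockSubst, Sum.elim_inl, aeval_X]

end TransferQP

open TransferQP in
/-- **Stub 3c — Bürgisser's Theorem 4.1(2) at quasi-polynomial granularity, with powers and an integer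
multiplier** (assembly), from the signed witness (3a, first hypothesis), the explicit algebraic core (3b, second
hypothesis), `τ(DET_m) = m^{O(1)}`, sign-determinantal expressions of quasi-polynomial size (SignDetQP) and the
collapse `CH ⊆ qpSIZE`: every coefficient sequence definable in `CH` has, for all large `n`, some
`N ≠ 0, e, d ≥ 1` with `τ(N · (2^e · Σ_{k ≤ q n} b(n,k) X^k)^d) ≤ 2^((log₂ log₂ n + c)^c)`.
[cite: Burgisser2009, Thm. 4.1(2)] [cite: Koiran2004, Thm. 6.1] -/
theorem stub_transferQP :
    (∀ (p q : ℕ → ℕ) (n M : ℕ) (CFp CFm : CircuitFamily),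
      n ≤ p n →
      (∀ m, (CFp m).IsOver B2) → (∀ m, (CFm m).IsOver B2) →
      (∀ m, m ≤ 8 * (bitLen (p n) + bitLen (q n)) + 9 → (CFp m).size ≤ M) →
      (∀ m, m ≤ 8 * (bitLen (p n) + bitLen (q n)) + 9 → (CFm m).size ≤ M) →
      ∃ P : ArithCircuit ℤ
          (KoiranVars (bitLen (p n)) (bitLen (q n)) ⊕
            Fin (bitLen (p n) + bitLen (q n) + M + 1)),
        P.IsFanInTwo ∧ P.HasSignConstants ∧
        P.size ≤ 160 * (bitLen (p n) + bitLen (q n) + M + 1) ^ 5 + 6 ∧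
        P.formalDegree ≤ 6 * (bitLen (p n) + bitLen (q n) + M) + 15 ∧
        MvPolynomial.aeval (blockSubst p q n) (boolSum P.eval) =
          twoBlockPoly p q
              (fun n' k j => (CFp (encBitQuery n' k j true).length).eval
                (encBitQuery n' k j true).get) n -
            twoBlockPoly p q
              (fun n' k j => (CFm (encBitQuery n' k j true).length).eval
                (encBitQuery n' k j true).get) n) →
    (∀ (σ τ : Type) [Fintype σ] (u S D cd n₀ cA : ℕ)
      (P : ArithCircuit ℤ (σ ⊕ Fin u)) (g : σ → MvPolynomial τ ℤ),
      P.IsFanInTwo → P.HasSignConstants → P.size ≤ S → P.formalDegree ≤ D →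
      (∀ m, constantFreeComplexity (detPoly (Fin m) ℤ) ≤ m ^ cd + cd) →
      (∀ pd ≥ n₀, ∃ (m d : ℕ) (N : ℤ) (A : Matrix (Fin m) (Fin m) (MvPolynomial (Fin pd × Fin pd) ℤ)),
          1 ≤ d ∧ m ≤ 2 ^ ((Nat.log 2 pd + cA) ^ cA) ∧ N ≠ 0 ∧ (∀ i j, (A i j).totalDegree ≤ 1) ∧
            (∀ i j s, |MvPolynomial.coeff s (A i j)| ≤ 1) ∧
            A.det = MvPolynomial.C N * perPoly (Fin pd) ℤ ^ d) →
      ∃ (N : ℤ) (e d : ℕ), N ≠ 0 ∧ 1 ≤ d ∧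
        constantFreeComplexity
            (MvPolynomial.C N * (MvPolynomial.C ((2 : ℤ) ^ e) * MvPolynomial.aeval g (boolSum P.eval)) ^ d) ≤
          (2 ^ ((Nat.log 2 (max n₀ (ArithCircuit.cfBound S D u + S + 2)) + cA) ^ cA)) ^ cd + cd +
            (2 ^ ((Nat.log 2 (max n₀ (ArithCircuit.cfBound S D u + S + 2)) + cA) ^ cA)) ^ 2 *
              ((max n₀ (ArithCircuit.cfBound S D u + S + 2)) ^ 3 +
                4 * (max n₀ (ArithCircuit.cfBound S D u + S + 2)) ^ 2 + 1) +
            ∑ v, constantFreeComplexity (g v)) →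
    (IsPBounded fun m =>
        constantFreeComplexity
          (detPoly (Fin m) ℤ)) →
    (∃ c n₀ : ℕ, ∀ n ≥ n₀, ∃ (m d : ℕ) (N : ℤ)
        (A : Matrix (Fin m) (Fin m) (MvPolynomial (Fin n × Fin n) ℤ)),
        1 ≤ d ∧ m ≤ 2 ^ ((Nat.log 2 n + c) ^ c) ∧ N ≠ 0 ∧ (∀ i j, (A i j).totalDegree ≤ 1) ∧
          (∀ i j s, |MvPolynomial.coeff s (A i j)| ≤ 1) ∧
          A.det = MvPolynomial.C N * perPoly (Fin n) ℤ ^ d) →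
      (CH ⊆
        ⋃ c : ℕ, SIZE (fun n => 2 ^ ((Nat.log 2 n + c) ^ c))) →
      ∀ (q : ℕ → ℕ) (b : ℕ → ℕ → ℤ), IsCHDefinable q b →
        ∃ c n₁ : ℕ, ∀ n ≥ n₁, ∃ (N : ℤ) (e d : ℕ), N ≠ 0 ∧ 1 ≤ d ∧
          tauPoly
              (Polynomial.C N * (Polynomial.C ((2 : ℤ) ^ e) *
                ∑ k ∈ Finset.range (q n + 1), Polynomial.C (b n k) * Polynomial.X ^ k) ^ d) ≤
            2 ^ ((Nat.log 2 (Nat.log 2 n) + c) ^ c) := by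
  intro hW hCore hdet hS hCH q b hb
  obtain ⟨hq, ⟨cb, hcb⟩, ⟨Sg, hSg, hSg'⟩, ⟨B, hB, hB'⟩⟩ := hb
  obtain ⟨cd, hcd⟩ := hdet
  obtain ⟨cA, n₀, hA⟩ := hS
  -- (i) the sign handling at the `CH` level: the bit arrays of `b⁺` and `b⁻`
  have hLp : B ⊓ {x | (boolUnpair x).1 ∈ Sg} ∈ CH := inter_mem_CH hB (CH_closed_fst Sg hSg)
  have hLm : B ⊓ {x | (boolUnpair x).1 ∈ Sgᶜ} ∈ CH := inter_mem_CH hB (CH_closed_fst Sgᶜ (compl_mem_CH hSg))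
  -- (ii) `CH ⊆ qpSIZE`: two circuit families of quasi-polynomial size
  obtain ⟨cp, CFp, hCFp, hdecp⟩ : ∃ (c : ℕ) (C : CircuitFamily),
      (∀ m, (C m).IsOver B2 ∧ (C m).size ≤ 2 ^ ((Nat.log 2 m + c) ^ c)) ∧
        C.Decides (B ⊓ {x | (boolUnpair x).1 ∈ Sg}) := by
    simpa only [Set.mem_iUnion, SIZE, Set.mem_setOf_eq] using hCH hLp
  obtain ⟨cm, CFm, hCFm, hdecm⟩ : ∃ (c : ℕ) (C : CircuitFamily),
      (∀ m, (C m).IsOver B2 ∧ (C m).size ≤ 2 ^ ((Nat.log 2 m + c) ^ c)) ∧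
        C.Decides (B ⊓ {x | (boolUnpair x).1 ∈ Sgᶜ}) := by
    simpa only [Set.mem_iUnion, SIZE, Set.mem_setOf_eq] using hCH hLm
  -- the two 0/1 arrays decided by the circuits are the bit arrays of `b⁺`, `b⁻` on the index domain
  have hfst : ∀ n k j, (boolUnpair (encBitQuery n k j true)).1 = encIdx n k := fun n k j => by
    simp [encBitQuery]
  have hbp : ∀ n k j, k ≤ q n → (CFp (encBitQuery n k j true).length).eval (encBitQuery n k j true).get =
      (decide (0 ≤ b n k) && (b n k).natAbs.testBit j) := by
    intro n k j hk
    rw [hdecp (encBitQuery n k j true)]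
    apply Bool.eq_iff_iff.2
    rw [← Set.mem_iff_boolIndicator]
    change encBitQuery n k j true ∈ B ∧ (boolUnpair (encBitQuery n k j true)).1 ∈ Sg ↔ _
    rw [hB' n k j true hk, hfst, hSg' n k hk, Bool.and_eq_true, decide_eq_true_iff, and_comm]
  have hbm : ∀ n k j, k ≤ q n → (CFm (encBitQuery n k j true).length).eval (encBitQuery n k j true).get =
      (decide (b n k < 0) && (b n k).natAbs.testBit j) := by
    intro n k j hk
    rw [hdecm (encBitQuery n k j true)]
    apply Bool.eq_iff_iff.2
    rw [← Set.mem_iff_boolIndicator]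
    change encBitQuery n k j true ∈ B ∧ (boolUnpair (encBitQuery n k j true)).1 ∈ Sgᶜ ↔ _
    rw [hB' n k j true hk, hfst]
    change _ ∧ encIdx n k ∉ Sg ↔ _
    rw [hSg' n k hk, Bool.and_eq_true, decide_eq_true_iff, and_comm, not_le]
  -- the bit bound `p(n) = n^cb + n ≥ n`
  set pf : ℕ → ℕ := fun n => n ^ cb + n with hpf
  have hp : IsPBounded pf := IsPBounded.add_holds (IsPBounded.pow_holds IsPBounded.id cb) IsPBounded.id
  have hpn : ∀ n, n ≤ pf n := fun n => Nat.le_add_left _ _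
  -- the constants
  obtain ⟨cT, hcT⟩ := coreBound_qp (max cp cm) cA cd n₀
  obtain ⟨cR, hcR⟩ : ∃ cR : ℕ, ∀ n, bitLen (pf n) + bitLen (q n) ≤ (Nat.log 2 n + 2) ^ cR :=
    polylog_add (polylog_bitLen hp) (polylog_bitLen hq)
  obtain ⟨cF, hcF⟩ := final_bound cT cR
  refine ⟨cF, 2, fun n hn => ?_⟩
  -- digit counts and the block size at `n`
  set ℓ := bitLen (pf n) with hℓ
  set μ := bitLen (q n) with hμ
  set M := 2 ^ ((Nat.log 2 (8 * (ℓ + μ) + 9) + max cp cm) ^ max cp cm) with hM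
  have hsize : ∀ (c : ℕ) (CF : CircuitFamily), c ≤ max cp cm →
      (∀ m, (CF m).IsOver B2 ∧ (CF m).size ≤ 2 ^ ((Nat.log 2 m + c) ^ c)) →
      ∀ m, m ≤ 8 * (ℓ + μ) + 9 → (CF m).size ≤ M := by
    intro c CF hc hCF m hm
    refine (hCF m).2.trans (Nat.pow_le_pow_right Nat.two_pos ?_)
    calc (Nat.log 2 m + c) ^ c ≤ (Nat.log 2 (8 * (ℓ + μ) + 9) + c) ^ c :=
          Nat.pow_le_pow_left (Nat.add_le_add_right (Nat.log_mono_right hm) _) _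
      _ ≤ (Nat.log 2 (8 * (ℓ + μ) + 9) + max cp cm) ^ max cp cm := IsQPBounded.qexp_mono _ hc
  -- (3a) the signed witness
  obtain ⟨P, hP2, hPsc, hPs, hPdeg, hPid⟩ := hW pf q n M CFp CFm (hpn n) (fun m => (hCFp m).1)
    (fun m => (hCFm m).1) (hsize cp CFp (le_max_left _ _) hCFp) (hsize cm CFm (le_max_right _ _) hCFm)
  -- the substitution `powers ∘ blockSubst`
  set ψ : Fin ℓ ⊕ Fin μ → MvPolynomial (Fin 1) ℤ :=
    Sum.elim (fun i : Fin ℓ => (C (2 : ℤ) : MvPolynomial (Fin 1) ℤ) ^ 2 ^ (i : ℕ))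
      (fun i : Fin μ => (X 0 : MvPolynomial (Fin 1) ℤ) ^ 2 ^ (i : ℕ)) with hψ
  set g : KoiranVars ℓ μ → MvPolynomial (Fin 1) ℤ := fun v => aeval ψ (blockSubst pf q n v) with hg
  -- (3b) the core at `σ = KoiranVars ℓ μ`, `τ = Fin 1`
  obtain ⟨N, e, d, hN, hd, hbound⟩ := hCore (KoiranVars ℓ μ) (Fin 1) (ℓ + μ + M + 1)
    (160 * (ℓ + μ + M + 1) ^ 5 + 6) (6 * (ℓ + μ + M) + 15) cd n₀ cA P g hP2 hPsc hPs hPdeg hcd hA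
  refine ⟨N, e, d, hN, hd, ?_⟩
  -- (iii) identify the polynomial: `(Σ_e P)(g) = Σ_k b(n,k) X^k`
  have hbits : ∀ k, k ≤ q n → (b n k).natAbs < 2 ^ (pf n + 1) := by
    intro k hk
    have h1 : |b n k| ≤ 2 ^ (n ^ cb) := hcb n k hn hk
    have h2 : ((b n k).natAbs : ℤ) ≤ 2 ^ (n ^ cb) := by rwa [Int.natCast_natAbs]
    have h3 : (b n k).natAbs ≤ 2 ^ (n ^ cb) := by exact_mod_cast h2
    exact lt_of_le_of_lt h3 (Nat.pow_lt_pow_right (by norm_num) (by simp only [hpf]; omega))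
  have hid : aeval g (boolSum P.eval) = ∑ k ∈ Finset.range (q n + 1), C (b n k) * (X 0 : MvPolynomial (Fin 1) ℤ) ^ k := by
    have hcomp : aeval g (boolSum P.eval) = aeval ψ (aeval (blockSubst pf q n) (boolSum P.eval)) := by
      rw [hg, ← AlgHom.comp_apply, MvPolynomial.comp_aeval]
    rw [hcomp, hPid, hψ]
    exact aeval_powers_twoBlockPoly_sub pf q b _ _ n (fun k j hk => hbp n k j hk) (fun k j hk => hbm n k j hk) hbits
  -- (iv) the bookkeeping
  rw [tauPoly_C_mul_pow_sum, ← hid]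
  have hgcost : ∑ v, constantFreeComplexity (g v) ≤ ℓ ^ 2 + μ ^ 2 := by
    rw [hg, hψ]; exact sum_cost_powers_blockSubst pf q n
  have hr2 : ℓ ^ 2 + μ ^ 2 ≤ (ℓ + μ) ^ 2 := by nlinarith
  calc constantFreeComplexity (C N * (C ((2 : ℤ) ^ e) * aeval g (boolSum P.eval)) ^ d)
      ≤ _ := hbound
    _ ≤ (2 ^ ((Nat.log 2 (max n₀ (ArithCircuit.cfBound (160 * (ℓ + μ + M + 1) ^ 5 + 6) (6 * (ℓ + μ + M) + 15)
            (ℓ + μ + M + 1) + (160 * (ℓ + μ + M + 1) ^ 5 + 6) + 2)) + cA) ^ cA)) ^ cd + cd +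
          (2 ^ ((Nat.log 2 (max n₀ (ArithCircuit.cfBound (160 * (ℓ + μ + M + 1) ^ 5 + 6) (6 * (ℓ + μ + M) + 15)
            (ℓ + μ + M + 1) + (160 * (ℓ + μ + M + 1) ^ 5 + 6) + 2)) + cA) ^ cA)) ^ 2 *
            ((max n₀ (ArithCircuit.cfBound (160 * (ℓ + μ + M + 1) ^ 5 + 6) (6 * (ℓ + μ + M) + 15)
              (ℓ + μ + M + 1) + (160 * (ℓ + μ + M + 1) ^ 5 + 6) + 2)) ^ 3 +
              4 * (max n₀ (ArithCircuit.cfBound (160 * (ℓ + μ + M + 1) ^ 5 + 6) (6 * (ℓ + μ + M) + 15)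
                (ℓ + μ + M + 1) + (160 * (ℓ + μ + M + 1) ^ 5 + 6) + 2)) ^ 2 + 1) +
          (ℓ + μ) ^ 2 := Nat.add_le_add_left (hgcost.trans hr2) _
    _ ≤ 2 ^ ((Nat.log 2 (ℓ + μ) + cT) ^ cT) := hcT (ℓ + μ) M _ _ _ _ _ hM rfl rfl rfl rfl rfl
    _ ≤ 2 ^ ((Nat.log 2 (Nat.log 2 n) + cF) ^ cF) := hcF n (ℓ + μ) (hcR n)

end Summit.ValiantsHypothesis.ValiantsHypothesis.Theorems.IntegralOrbitsTauBurgisserDet
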